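import Summits.KontsevichZagierPeriods.KontsevichZagierPeriods.Theses.LinkTwistWrithe
import Literature.NumberTheory.Transcendental.SemialgebraicMapsProofs
import Literature.NumberTheory.Transcendental.KZLogCalculusProofs

/-!
# `DegreeTransfer` (stmt-KontsevichZagierPeriods-4306, route LinkTwistWrithe, crux rank 4) — birth skeleton

Crux (verbatim the route decl `…Theses.LinkTwistWrithe.DegreeTransfer`): for a representation
`r = [r.domain, f]`, sheets `σ_k ⊆ r.domain` (`k < N`, `ℚ`-semialgebraic, co-null union, possibly
overlapping), maps `Φ_k` (`ℚ`-semialgebraic on `σ_k`, injective, derivative `Φ_k′` WITHIN `σ_k`,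
images in `r′.domain`), weights `ε_k ∈ ℤ`, the integrand identity
`f = Σ_k 1_{σ_k}·ε_k·(g∘Φ_k)·|det Φ_k′|` on `⋃σ_k` (`g = r′.integrand`) and the signed count
`Σ_k ε_k·1_{Φ_k(σ_k)} = d` a.e. on `r′.domain`, one has `[r] − d·[r′] ∈ KZ.relations`.

Line ("peel · transfer · count" — the mapping-degree formula cut at its two natural joints, the
formal sum of SOURCE sheets `Σ_k ε_k [s_k]` and the formal sum of IMAGE sheets `Σ_k ε_k [r′|Φ_k(σ_k)]`):

* `stub_signedPeel` (P, source side, size L) — SIGNED PEELING ONTO A.E.-SHEETS: under the crux data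
  WITHOUT the count hypothesis there are sheet representations `s_k` with `s_k.domain ⊆ σ_k` CO-NULL in
  `σ_k` and integrand `(g∘Φ_k)·|det Φ_k′|` pointwise on `s_k.domain`, such that
  `[r] − Σ_k ε_k • [s_k] ∈ KZ.relations`. The null damage is essential and is the content: where the
  derivative within `σ_k` is not unique (`σ_k ∖ interior σ_k`, a null semialgebraic set) the datum
  `Φ_k′` is arbitrary, so `x ↦ |det Φ_k′ x|` need not be semialgebraic and `[σ_k, (g∘Φ_k)|det Φ_k′|]`
  need not be an `IntegralRep` (e.g. `σ_k` a point, `Φ_k′ = π·id`): the prover discards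
  `σ_k ∖ interior σ_k` (`isSemialgebraic_interior`, `KZ.volume_eq_zero_of_interior_eq_empty`,
  `KZ.of_mem_relations_of_volume_eq_zero`), where `Φ_k′ = fderiv Φ_k` is semialgebraic
  (first-order graph: `hasFDerivWithinAt_iff_coord` + `isSemialgebraic_of_definable`, or definable
  choice `exists_mem_isSemialgebraic_singleton` as in `DefinableMoves.CovTransfer_proof`; partials:
  `IsSemialgebraicFunOn.hasDerivAt_last_isSemialgebraic_holds`), then peels the `N` summands by
  iterated integrand additivity over the common domain (`KZ.of_sub_of_sub_sum_mem_relations`,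
  integrability of each summand from `r′.integrableOn` by
  `MeasureTheory.integrableOn_image_iff_integrableOn_abs_det_fderiv_smul`), localises each summand to
  its sheet by domain additivity (`[S, 1_σ h] = [σ, h] + [S ∖ σ, 0]`, `KZ.of_mem_relations_of_eqOn_zero`)
  and extracts the integer weight (`[σ, m·h] ~ m • [σ, h]` by integrand additivity).
* `stub_sheetImage` (T, one sheet, size M) — RULE 2 TOLERATES NULL DAMAGE OF THE SOURCE: a sheet
  representation `s` on a co-null semialgebraic part of `σ` with integrand `(g∘Φ)·|det Φ′|` is
  KZ-equivalent to `t = [Φ(σ), g]` on the FULL image: one change-of-variables move onto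
  `Φ(s.domain)` (`IsSemialgebraicMapOn.isSemialgebraic_image_holds`, `HasFDerivWithinAt.mono`) and the
  remainder `Φ(σ) ∖ Φ(s.domain) ⊆ Φ(σ ∖ s.domain)` is a null semialgebraic set
  (`MeasureTheory.addHaar_image_eq_zero_of_differentiableOn_of_addHaar_eq_zero`), discarded by domain
  additivity.
* `stub_signedCount` (C, target side, size M/L) — AN A.E.-CONSTANT SIGNED COVER IS `d` COPIES, INSIDE
  THE RULES: for sub-representations `t_k` of `r′` (`t_k.domain ⊆ r′.domain`, same integrand there) with
  `Σ_k ε_k 1_{t_k.domain} = d` a.e. on `r′.domain`, `Σ_k ε_k • [t_k] − d • [r′] ∈ KZ.relations` — no maps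
  at all: the Boolean atoms `R_J = r′.domain ∩ ⋂_{k∈J} t_k.domain ∩ ⋂_{k∉J} t_k.domainᶜ` are
  `ℚ`-semialgebraic and partition every `t_k.domain` and `r′.domain` (iterated domain additivity);
  on a non-null atom `Σ_{k∈J} ε_k = d`, a null atom is a relation.

Composition `DegreeTransfer_of : stub₁-sig → stub₂-sig → stub₃-sig → DegreeTransfer` (sorry-free):
with `t_k := r′.restrict (Φ_k '' σ_k)` (semialgebraic image), (P) gives `[r] − Σ ε_k•[s_k]`, (T) gives
each `[s_k] − [t_k]`, (C) gives `Σ ε_k•[t_k] − d•[r′]`, all in `KZ.relations`; add them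
(`sum_mem`, `zsmul_mem`, `abel`). `DegreeTransfer_skeleton : DegreeTransfer` feeds the three stubs in.

Honesty / strength: the VALUE identity behind the crux is the area formula, so none of the three stubs
carries transcendence; each is an unconditional statement about the fixed calculus whose only risk is
AS TYPED (side conditions). (P) is where the grounder's "missing side condition" risk lives (it is
repaired, not assumed: the stub concludes on a.e.-sheets); (C) is pure scissors congruence; (T) is the
reusable "damaged sheet" form of rule 2 (also what `MultivaluedCoV.SheetTransfer` stmt-2877 and
`CobordismMove.SignedSheetTransfer` stmt-5567 — the grounder's verbatim twin of this crux — need).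

Disproof used: none on file (`ledger crux ls stmt-KontsevichZagierPeriods-4306`: no workfiles, no
`Disproof.lean`, no `Theorems/…/Negative/*`); `ledger negatives --problem KontsevichZagierPeriods` has one
entry (KinematicPlaneConvex, stmt-5394), unrelated. All statements are over existing declarations
(`Literature.NumberTheory.Transcendental.KZ.*` of `KZCalculus`, `IsSemialgebraicMapOn`,
`Literature.ModelTheory.ExponentialFields.IsSemialgebraic`, Mathlib).
-/

set_option linter.dupNamespace false

namespace Summit.KontsevichZagierPeriods.KontsevichZagierPeriods.Cruxes.DegreeTransfer.Birth

open scoped BigOperators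
open MeasureTheory Set
open Literature.NumberTheory.Transcendental
open Summit.KontsevichZagierPeriods.KontsevichZagierPeriods.Theses.LinkTwistWrithe (DegreeTransfer)

/-! ### The three statements of the line (named; each is registered below as a `stub_…`) -/

/-- **(P) Signed peeling onto a.e.-sheets** — the statement of `stub_signedPeel`: the crux data
without the count hypothesis yield sheet representations `s_k` on co-null semialgebraic parts of the
`σ_k`, with integrand `(r′.integrand ∘ Φ_k)·|det Φ_k′|` there, and `[r] − Σ_k ε_k • [s_k] ∈ KZ.relations`.
[cite: KontsevichZagier2001, §1.2 rules (1), (2)] [cite: BochnakCosteRoy1998, Prop. 2.2.7, §2.8] -/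
def SignedPeel : Prop :=
  ∀ (n N : ℕ) (ε : Fin N → ℤ) (r r' : KZ.IntegralRep n) (σ : Fin N → Set (Fin n → ℝ))
    (Φ : Fin N → (Fin n → ℝ) → (Fin n → ℝ)) (Φ' : Fin N → (Fin n → ℝ) → ((Fin n → ℝ) →L[ℝ] (Fin n → ℝ))),
    (∀ k, Literature.ModelTheory.ExponentialFields.IsSemialgebraic ℚ (σ k)) →
    (∀ k, σ k ⊆ r.domain) → volume (r.domain \ ⋃ k, σ k) = 0 →
    (∀ k, IsSemialgebraicMapOn ℚ (σ k) (Φ k)) →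
    (∀ k, ∀ x ∈ σ k, HasFDerivWithinAt (Φ k) (Φ' k x) (σ k) x) →
    (∀ k, InjOn (Φ k) (σ k)) → (∀ k, Φ k '' σ k ⊆ r'.domain) →
    (∀ x ∈ ⋃ k, σ k, r.integrand x =
      ∑ k : Fin N, (σ k).indicator (fun y => (ε k : ℝ) * (r'.integrand (Φ k y) * |(Φ' k y).det|)) x) →
    ∃ s : Fin N → KZ.IntegralRep n,
      (∀ k, (s k).domain ⊆ σ k) ∧ (∀ k, volume (σ k \ (s k).domain) = 0) ∧
      (∀ k, ∀ x ∈ (s k).domain, (s k).integrand x = r'.integrand (Φ k x) * |(Φ' k x).det|) ∧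
      KZ.of r - ∑ k, ε k • KZ.of (s k) ∈ KZ.relations

/-- **(T) Rule 2 tolerates null damage of the source sheet** — the statement of `stub_sheetImage`:
a representation `s` on a co-null semialgebraic part of `σ` with integrand `(t.integrand ∘ Φ)·|det Φ′|`
is KZ-equivalent to `t = [Φ(σ), t.integrand]` on the full image.
[cite: KontsevichZagier2001, §1.2 rule (2)] [cite: BochnakCosteRoy1998, Prop. 2.2.7] -/
def SheetImage : Prop :=
  ∀ (n : ℕ) (σ : Set (Fin n → ℝ)) (Φ : (Fin n → ℝ) → (Fin n → ℝ))
    (Φ' : (Fin n → ℝ) → ((Fin n → ℝ) →L[ℝ] (Fin n → ℝ))) (s t : KZ.IntegralRep n),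
    Literature.ModelTheory.ExponentialFields.IsSemialgebraic ℚ σ →
    IsSemialgebraicMapOn ℚ σ Φ → (∀ x ∈ σ, HasFDerivWithinAt Φ (Φ' x) σ x) → InjOn Φ σ →
    s.domain ⊆ σ → volume (σ \ s.domain) = 0 →
    (∀ x ∈ s.domain, s.integrand x = t.integrand (Φ x) * |(Φ' x).det|) →
    t.domain = Φ '' σ →
    KZ.of s - KZ.of t ∈ KZ.relations

/-- **(C) An a.e.-constant signed cover is `d` copies, inside the rules** — the statement of
`stub_signedCount`: for sub-representations `t_k` of `r′` whose signed indicator count is `d` a.e. on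
`r′.domain`, `Σ_k ε_k • [t_k] − d • [r′] ∈ KZ.relations` (Boolean atoms; domain additivity only).
[cite: KontsevichZagier2001, §1.2 rule (1)] [cite: Kauffman1991, p. 281] -/
def SignedCount : Prop :=
  ∀ (n N : ℕ) (d : ℤ) (ε : Fin N → ℤ) (r' : KZ.IntegralRep n) (t : Fin N → KZ.IntegralRep n),
    (∀ k, (t k).domain ⊆ r'.domain) → (∀ k, EqOn (t k).integrand r'.integrand (t k).domain) →
    (∀ᵐ y ∂(volume.restrict r'.domain),
      (∑ k : Fin N, ((t k).domain).indicator (fun _ => ε k) y) = d) →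
    ∑ k, ε k • KZ.of (t k) - d • KZ.of r' ∈ KZ.relations

/-! ### Registered stubs (the only `sorry`s of this file) -/

/-- **STUB P — SIGNED PEELING ONTO A.E.-SHEETS** (size L; the side-condition-bearing stub). Under the
crux data minus the count hypothesis: sheet representations `s_k`, `s_k.domain ⊆ σ_k` co-null in `σ_k`,
integrand `(r′.integrand ∘ Φ_k)·|det Φ_k′|` on `s_k.domain`, with `[r] − Σ_k ε_k • [s_k] ∈ KZ.relations`.
Plan: discard `r.domain ∖ ⋃σ_k` (null, semialgebraic) and the null semialgebraic sets
`σ_k ∖ interior σ_k` (`isSemialgebraic_interior`, `KZ.volume_eq_zero_of_interior_eq_empty`,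
`KZ.of_mem_relations_of_volume_eq_zero`) — on `interior σ_k` the derivative within `σ_k` is `fderiv Φ_k`,
a semialgebraic matrix function (first-order graph of the derivative: `hasFDerivWithinAt_iff_coord`,
`isSemialgebraic_of_definable`; or definable choice `exists_mem_isSemialgebraic_singleton` as in
`DefinableMoves.CovTransfer_proof`), so every summand `1_{σ_k}·ε_k·(g∘Φ_k)·|det Φ_k′|` becomes a genuine
`IntegralRep` on the common domain (semialgebraic: `comp_isSemialgebraicMapOn_holds`, `mul_holds`, `abs`;
integrable: `MeasureTheory.integrableOn_image_iff_integrableOn_abs_det_fderiv_smul` from `r′.integrableOn`,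
`InjOn`, images in `r′.domain`); peel by `KZ.of_sub_of_sub_sum_mem_relations`, localise by domain
additivity (`[S, 1_σ h] − [σ, h] − [S ∖ σ, 0]`, `KZ.of_mem_relations_of_eqOn_zero`), pull out `ε_k`
(`[σ, m h] ~ m • [σ, h]`, induction on `|m|` with integrand additivity and `IntegralRep.neg`).
Why it might fail: only as typed — a forgotten measurability/semialgebraicity of an intermediate
partial sum; the conclusion is deliberately on a.e.-sheets so that the non-uniqueness of `Φ_k′` off
`interior σ_k` cannot bite. [cite: KontsevichZagier2001, §1.2 rules (1), (2)]
[cite: BochnakCosteRoy1998, §2.8 and Prop. 2.2.7] [cite: BasuPollackRoy2006, §3.5 (Prop. 3.22)] -/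
theorem stub_signedPeel :
    ∀ (n N : ℕ) (ε : Fin N → ℤ) (r r' : KZ.IntegralRep n) (σ : Fin N → Set (Fin n → ℝ))
      (Φ : Fin N → (Fin n → ℝ) → (Fin n → ℝ)) (Φ' : Fin N → (Fin n → ℝ) → ((Fin n → ℝ) →L[ℝ] (Fin n → ℝ))),
      (∀ k, Literature.ModelTheory.ExponentialFields.IsSemialgebraic ℚ (σ k)) →
      (∀ k, σ k ⊆ r.domain) → volume (r.domain \ ⋃ k, σ k) = 0 →
      (∀ k, IsSemialgebraicMapOn ℚ (σ k) (Φ k)) →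
      (∀ k, ∀ x ∈ σ k, HasFDerivWithinAt (Φ k) (Φ' k x) (σ k) x) →
      (∀ k, InjOn (Φ k) (σ k)) → (∀ k, Φ k '' σ k ⊆ r'.domain) →
      (∀ x ∈ ⋃ k, σ k, r.integrand x =
        ∑ k : Fin N, (σ k).indicator (fun y => (ε k : ℝ) * (r'.integrand (Φ k y) * |(Φ' k y).det|)) x) →
      ∃ s : Fin N → KZ.IntegralRep n,
        (∀ k, (s k).domain ⊆ σ k) ∧ (∀ k, volume (σ k \ (s k).domain) = 0) ∧
        (∀ k, ∀ x ∈ (s k).domain, (s k).integrand x = r'.integrand (Φ k x) * |(Φ' k x).det|) ∧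
        KZ.of r - ∑ k, ε k • KZ.of (s k) ∈ KZ.relations := by
  sorry

/-- **STUB T — RULE 2 TOLERATES NULL DAMAGE OF THE SOURCE SHEET** (size M; reusable by every sheet
count in the tree). For `s.domain ⊆ σ` co-null, `Φ` semialgebraic / differentiable-within / injective
on `σ`, `s.integrand = (t.integrand ∘ Φ)·|det Φ′|` on `s.domain` and `t.domain = Φ '' σ`:
`[s] − [t] ∈ KZ.relations`. Plan: one `changeOfVariablesRel` instance from `s` onto
`t.restrict (Φ '' s.domain)` (`IsSemialgebraicMapOn.mono`, `isSemialgebraic_image_holds`,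
`HasFDerivWithinAt.mono`, `InjOn.mono`), then domain additivity
`[t] = [t|Φ(s.domain)] + [t|Φ(σ) ∖ Φ(s.domain)]`, the second piece null because
`Φ(σ) ∖ Φ(s.domain) ⊆ Φ(σ ∖ s.domain)` and differentiable maps send null sets to null sets
(`MeasureTheory.addHaar_image_eq_zero_of_differentiableOn_of_addHaar_eq_zero`), hence a relation
(`KZ.of_mem_relations_of_volume_eq_zero`). Why it might fail: it should not; the one delicate point is
that the null-image lemma wants `DifferentiableOn` on `σ ∖ s.domain`, supplied by `HasFDerivWithinAt.mono`.
[cite: KontsevichZagier2001, §1.2 rule (2)] [cite: BochnakCosteRoy1998, Prop. 2.2.7] -/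
theorem stub_sheetImage :
    ∀ (n : ℕ) (σ : Set (Fin n → ℝ)) (Φ : (Fin n → ℝ) → (Fin n → ℝ))
      (Φ' : (Fin n → ℝ) → ((Fin n → ℝ) →L[ℝ] (Fin n → ℝ))) (s t : KZ.IntegralRep n),
      Literature.ModelTheory.ExponentialFields.IsSemialgebraic ℚ σ →
      IsSemialgebraicMapOn ℚ σ Φ → (∀ x ∈ σ, HasFDerivWithinAt Φ (Φ' x) σ x) → InjOn Φ σ →
      s.domain ⊆ σ → volume (σ \ s.domain) = 0 →
      (∀ x ∈ s.domain, s.integrand x = t.integrand (Φ x) * |(Φ' x).det|) →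
      t.domain = Φ '' σ →
      KZ.of s - KZ.of t ∈ KZ.relations := by
  sorry

/-- **STUB C — AN A.E.-CONSTANT SIGNED COVER IS `d` COPIES, INSIDE THE RULES** (size M/L; the
combinatorial heart of "degree is a move"). For sub-representations `t_k` of `r′` with
`Σ_k ε_k 1_{t_k.domain} = d` a.e. on `r′.domain`: `Σ_k ε_k • [t_k] − d • [r′] ∈ KZ.relations`.
Plan: the `2^N` Boolean atoms `R_J = r′.domain ∩ ⋂_{k∈J} t_k.domain ∩ ⋂_{k∉J} (t_k.domain)ᶜ` are
`ℚ`-semialgebraic (`IsSemialgebraic.inter/.compl`), pairwise disjoint, and partition `r′.domain` and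
each `t_k.domain` (`J ∋ k`); iterated domain additivity (`KZ.of_glue_sub_sub_mem_domainAddRel` pattern,
induction over a `Finset` of atoms) gives `[t_k] ~ Σ_{J∋k} [r′|R_J]` and `[r′] ~ Σ_J [r′|R_J]`; the
coefficient of `[r′|R_J]` in `Σ_k ε_k [t_k] − d [r′]` is `Σ_{k∈J} ε_k − d`, which vanishes unless `R_J`
is null (the a.e. hypothesis evaluated at a point of the positive-measure atom, where the indicator sum
IS `Σ_{k∈J} ε_k`), and a null atom is a relation (`KZ.of_mem_relations_of_volume_eq_zero`). Edge cases:
`N = 0` forces `d = 0` or `r′.domain` null — both fine. Why it might fail: it should not; the Lean cost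
is the finite bookkeeping in `FreeAbelianGroup` over `Finset (Finset (Fin N))`.
[cite: KontsevichZagier2001, §1.2 rule (1)] [cite: Kauffman1991, p. 281 (Cr(z) as a signed count)] -/
theorem stub_signedCount :
    ∀ (n N : ℕ) (d : ℤ) (ε : Fin N → ℤ) (r' : KZ.IntegralRep n) (t : Fin N → KZ.IntegralRep n),
      (∀ k, (t k).domain ⊆ r'.domain) → (∀ k, EqOn (t k).integrand r'.integrand (t k).domain) →
      (∀ᵐ y ∂(volume.restrict r'.domain),
        (∑ k : Fin N, ((t k).domain).indicator (fun _ => ε k) y) = d) →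
      ∑ k, ε k • KZ.of (t k) - d • KZ.of r' ∈ KZ.relations := by
  sorry

/-! ### Consistency: each named statement IS its registered stub (definitionally) -/

theorem signedPeel_holds : SignedPeel := stub_signedPeel
theorem sheetImage_holds : SheetImage := stub_sheetImage
theorem signedCount_holds : SignedCount := stub_signedCount

/-! ### Name-keyed aliases of the three statements — the hypotheses of `DegreeTransfer_of`

The native skeleton audit (`#h21_check_skeleton`) admits a hypothesis of a skeleton theorem only if its
head constant is a registered obligation or is NAMED like a declared stub; `__Registered.stub_X` is the
statement of `stub_X` under that name (device of `Cruxes/BoundedCost/Lines/birth.lean`). Each alias is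
`rfl`-equal to its statement. -/
namespace __Registered

/-- Alias of `SignedPeel` keyed by the registered stub name. -/
abbrev stub_signedPeel : Prop := SignedPeel
/-- Alias of `SheetImage` keyed by the registered stub name. -/
abbrev stub_sheetImage : Prop := SheetImage
/-- Alias of `SignedCount` keyed by the registered stub name. -/
abbrev stub_signedCount : Prop := SignedCount

end __Registered

/-! ### Sanity: the statements are inhabited-in-kind (no `sorry`) -/

/-- Special case of `stub_sheetImage` with no `sorry`: an UNDAMAGED sheet (`s.domain = σ`) transfers
onto its image by exactly one change-of-variables move. [cite: KontsevichZagier2001, §1.2 rule (2)] -/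
theorem sheetImage_undamaged (n : ℕ) (Φ : (Fin n → ℝ) → (Fin n → ℝ))
    (Φ' : (Fin n → ℝ) → ((Fin n → ℝ) →L[ℝ] (Fin n → ℝ))) (s t : KZ.IntegralRep n)
    (hΦ : IsSemialgebraicMapOn ℚ s.domain Φ) (hd : ∀ x ∈ s.domain, HasFDerivWithinAt Φ (Φ' x) s.domain x)
    (hinj : InjOn Φ s.domain)
    (hint : ∀ x ∈ s.domain, s.integrand x = t.integrand (Φ x) * |(Φ' x).det|)
    (ht : t.domain = Φ '' s.domain) : KZ.of s - KZ.of t ∈ KZ.relations :=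
  KZ.changeOfVariablesRel_subset_relations ⟨n, s, t, Φ, Φ', hΦ, hd, hinj, ht, hint, rfl⟩

/-- Special case of `stub_signedCount` with no `sorry`: ONE sheet covering the whole target once
(`N = 1`, `ε = 1`, `d = 1`, `t₀.domain = r′.domain`) is KZ congruence.
[cite: KontsevichZagier2001, §1.2 rule (1)] -/
theorem signedCount_one (n : ℕ) (r' t₀ : KZ.IntegralRep n) (hdom : t₀.domain = r'.domain)
    (hint : EqOn t₀.integrand r'.integrand t₀.domain) :
    ∑ k : Fin 1, (fun _ => (1 : ℤ)) k • KZ.of ((fun _ => t₀) k) - (1 : ℤ) • KZ.of r' ∈ KZ.relations := by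
  simpa using KZ.of_sub_of_mem_relations_of_eqOn hdom.symm (hdom ▸ hint)

/-! ### The composition (sorry-free) -/

/-- **Skeleton theorem, arrow form** (concludes the crux BY NAME; type
`stub_signedPeel-sig → stub_sheetImage-sig → stub_signedCount-sig → DegreeTransfer`, the hypotheses spelled
through the name-keyed aliases): with the image sheets `t_k := r′.restrict (Φ_k '' σ_k)` (semialgebraic
images, `IsSemialgebraicMapOn.isSemialgebraic_image_holds`), (P) gives `[r] − Σ ε_k • [s_k]`, (T) gives
every `[s_k] − [t_k]`, (C) gives `Σ ε_k • [t_k] − d • [r′]`, all in `KZ.relations`; their sum is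
`[r] − d • [r′]`. [cite: KontsevichZagier2001, §1.2] -/
theorem DegreeTransfer_of (hP : __Registered.stub_signedPeel) (hT : __Registered.stub_sheetImage)
    (hC : __Registered.stub_signedCount) : DegreeTransfer := by
  intro n N d ε r r' σ Φ Φ' h1 h2 h3 h4 h5 h6 h7 h8 h9
  -- the image sheets, sub-representations of `r'`
  have himg : ∀ k, Literature.ModelTheory.ExponentialFields.IsSemialgebraic ℚ (Φ k '' σ k) := fun k =>
    IsSemialgebraicMapOn.isSemialgebraic_image_holds (h4 k) Subset.rfl (h1 k)
  let t : Fin N → KZ.IntegralRep n := fun k => r'.restrict (Φ k '' σ k) (himg k) (h7 k)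
  -- (P) source side
  obtain ⟨s, hsσ, hsnull, hsint, hA⟩ := hP n N ε r r' σ Φ Φ' h1 h2 h3 h4 h5 h6 h7 h9
  -- (T) sheet by sheet
  have hB : ∀ k, KZ.of (s k) - KZ.of (t k) ∈ KZ.relations := fun k =>
    hT n (σ k) (Φ k) (Φ' k) (s k) (t k) (h1 k) (h4 k) (h5 k) (h6 k) (hsσ k) (hsnull k) (hsint k) rfl
  -- (C) target side
  have hC' : ∑ k, ε k • KZ.of (t k) - d • KZ.of r' ∈ KZ.relations :=
    hC n N d ε r' t (fun k => h7 k) (fun k _ _ => rfl) h8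
  have hB' : ∑ k, ε k • (KZ.of (s k) - KZ.of (t k)) ∈ KZ.relations :=
    sum_mem fun k _ => zsmul_mem (hB k) (ε k)
  have := KZ.relations.add_mem (KZ.relations.add_mem hA hB') hC'
  convert this using 1
  simp only [smul_sub, Finset.sum_sub_distrib]
  abel

/-- **Skeleton theorem, by name**: `DegreeTransfer` from the three registered stubs (its only `sorryAx`
dependencies are `stub_signedPeel`, `stub_sheetImage`, `stub_signedCount`).
[cite: KontsevichZagier2001, §1.2] -/
theorem DegreeTransfer_skeleton : DegreeTransfer :=
  DegreeTransfer_of stub_signedPeel stub_sheetImage stub_signedCount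

end Summit.KontsevichZagierPeriods.KontsevichZagierPeriods.Cruxes.DegreeTransfer.Birth
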